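import Literature.MathematicalPhysics.QuantumFieldTheory.Balaban1983to89.B13Term214WindowDilated

/-!
# `Balaban1983to89.B13Term214Centred` — T. Bałaban, *Renormalization group approach to lattice gauge field theories. II.
Cluster expansions*, Commun. Math. Phys. **116** (1988) 1–22 [Balaban1988RG2Cluster], p. 15, with [Balaban1987RG1]
(2.10)–(2.13) pp. 266–268: print's first estimate (2.15) applied to a CENTRED integrand of (2.14) — the last line minus a
reference last line minus an ODD linear part — after the joint reflection `(B, X) ↦ (−B, −X)` has killed the odd part
EXACTLY; the pointwise majorant of the centred printed last line in the (2.20)∕(2.22) currency; and the integrability of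
the actual (2.14) integrands from the (2.15)–(2.23) letters, which makes the complex Gaussian means LINEAR in the last line

statement-level skeleton of published theorems with citation tags; proofs where landed; nothing here is a claim about the
Yang–Mills mass gap

PDF held: `paper:balaban1988-cmp116-rg-ii-cluster` (journal page = PDF page + 0), p. 15 quoted in `B13Term214` ∕
`B13FirstEstimate215`; `paper:balaban1987-cmp109-rg-i` pp. 266–268 (render `b2b-balaban-ref1/pages/1987-cmp109-rg-I-small-field/…-p019/p020/p021-x2.png`).

CITATION HEADER.  [II] p. 15 [PDF 15]: *"The first estimate is* (2.15) *…"* (the modulus of the complex measure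
`dμ_{C^{(k)}(Z₀,σ(Z))}` is the positive measure `dμ_{(Re C^{(k)}(Z₀,σ(Z))⁻¹)⁻¹}` times `|det(…)/det Re(…)|^{1/2}`).  [I] p. 267
[PDF 20]: *"we make the scaling transformation B = g_kB′ … the third, linear term in (2.10) vanishes"*; p. 268, after (2.13):
*"Let us remark that the expression under the exponential above vanishes at g_k = 0"*.  Print records the vanishing of the
potential at zero coupling; the SECOND-ORDER vanishing of the centred Gaussian MEAN (what node N22's centred letter
(S-vertex-T′) asks) is not printed — what this file records is that it costs nothing beyond (2.15): an odd integrand has zero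
complex Gaussian integral (Lebesgue measure is reflection invariant, the weight `e^{−½⟨B,AB⟩}` is even for ANY complex
`A`), so (2.15) is applied to the integrand minus its odd first-order part, and only the second-order remainder is majorised.

PROVENANCE.  §1, §2 (first three lemmas), §3 (all but the Gaussian-shaped letter) and §4 are the tree twins, with
per-declaration credit, of the memo-only sketch
`run/shared/lean/pub/pub-ymgap/ym-lens-BalabanUVNodes-transfer/lean/LensTransferSketch12.lean` (seat
`ym-lens-BalabanUVNodes-transfer` g12, sha16 `4e7371746d136b7c`, Card T21 of `LENS-transfer.md` §18 *«the centred letter is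
print's (2.15) on a centred integrand»*), which located this road and OFFERED the module to node N10's lane; the σ-constant
annihilation of its §H («the centre of a σ-differentiated term is zero», Card T22) is ALREADY the tree's
`B13SigmaFreeKernels.cauchyD_const` ∕ `TopC_const_of_ne_nil` ∕ `term214_sigmaFree` (seat n10-c module 35) and is cited, not
restated.  Cell `pub-ymgap`, seat `pub-ymgap-dag-n10-c` (g6); consumer: node N22's (S-vertex-T′)
(`Summits/…/BalabanUVNodesN22W1RelCentredTermDatum214Generated`, `hdata` l.135–142), whose producer is unowned.

WHAT IS HERE (no definition).
* §1 PARITY: the complex Gaussian weight is even, the complex Gaussian integral ∕ mean are reflection invariant and vanish on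
  ODD integrands (`cgaussInt_eq_zero_of_odd`, `cgaussMean_eq_zero_of_odd` — no hypothesis on the precision); with an odd
  source `Γ` (any `X ↦ c·G·X`: `smul_mulVec_coe_neg`) and an odd last line, lines 2–3 of (2.14) are odd in `X` and their
  `dμ₀(X)`-mean is ZERO (`cgaussMean_integrand214_eq_zero_of_jointOdd`).
* §2 LINEARITY of the means in the last line under integrability (`cgaussMean_sub`, `integrand214_sub`), and the
  INTEGRABILITY of the actual inner ∕ outer integrands of (2.14) from the (2.15)–(2.23) letters
  (`integrable_inner_of_letters`: domination by the `B`-integrand of (2.23), `B13Core214Holomorphic.norm_innerIntegrand_le`;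
  `integrable_outer_of_letters`: measurability `aestronglyMeasurable_integrand214` + domination by `e^{2η|Λ|}K·`[(2.23)-integrand]).
* §3 THE CENTRED (2.15): `norm_cgaussMean_sub_le_215_centred` (measure line), `norm_core214_sub_le_215_centred` (lines 2–4:
  `‖∫dμ₀(X)(lines 2–3)(F) − ∫dμ₀(X)(lines 2–3)(F₀)‖ ≤` print's (2.15) right-hand side for any majorant `g` of `F − F₀ − ℓ`,
  `ℓ` odd); the centred printed last line `F214(𝐕) − F214(𝐕₀) − F214(𝐕₀)·Σ τ𝐕₁` — algebra (`F214_centred_eq`), pointwise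
  majorant (`norm_F214_centred_le`), its `O(s²)` forms under constant Taylor letters (`norm_F214_centred_le_sq`) and under
  (2.20)-SHAPED Taylor letters (`norm_F214_centred_le_gauss`: a Gaussian-shaped majorant `s²·χχᶜ·K_c·e^{½a_c‖B‖²}` ready for
  `B13Replacement223.replaced_le_226`), and the oddness of the linear part (`centredLinearPart_odd`).
* §4 THE CENTRE: with a field-constant last line and the Gaussian generating-function identity at the source `ΓX`, lines 2–3
  of (2.14) are the constant (`integrand214_const_of_mgf`: the compensator `e^{−½⟨ΓX,A⁻¹ΓX⟩}` of (2.14) is designed to cancel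
  the generating function) — so a term with a σ-operation has centre ZERO by `B13SigmaFreeKernels.term214_sigmaFree`.
HONEST SCOPE.  No Gaussian inequality beyond print's (2.15) (applied once, to a smaller integrand); the parity∕Taylor data of
a producer's last line (which pieces are even, which odd, the letters `a₁, w₁, a₂, w₂, w₀`) are HYPOTHESES here; the torus-level
(2.16)–(2.26) run on the centred majorant along the window-dilated family is `B13Bound226Centred`.  No `sorry`, no definition,
no new named fact (D-0026).
-/

noncomputable section

namespace Literature.MathematicalPhysics.QuantumFieldTheory.Balaban1983to89.B13Term214Centred

open Matrix MeasureTheory Finset Complex Metric Set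
open scoped Real
open B13GaugeDevices (gaussWeight gaussInt gaussNorm gaussMean)
open B2Eq228Conditioning (gaussNorm_pos gaussWeight_pos)
open B13Term214 (cquad cgaussWeight cgaussInt cgaussNorm cgaussMean integrand214 core214 F214)
open B13Integral223 (innerB posDef_inv_sub_smul integrable_weight_mul_integrand)
open B13FirstEstimate215 (cgaussNorm_ne_zero norm_cgaussWeight_eq_gaussWeight norm_integrand214_le_215
  norm_cgaussMean_le_215 norm_core214_le_215 norm_cexp_neg_dotProduct)
open B13Replacement223 (integrand215_replace_le integrable_hg215_gauss integrable_integrand223)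
open B13Core214Holomorphic (norm_innerIntegrand_le aestronglyMeasurable_integrand214)
open B13GaussParamHolomorphic (continuous_cgaussWeight)

variable {Λ : Type} [Fintype Λ] [DecidableEq Λ]

/-! ## §1. Parity: even weight, reflection-invariant complex mean, odd integrands integrate to zero -/

omit [DecidableEq Λ] in
/-- The complex quadratic form is even: `⟨−v, A(−v)⟩ = ⟨v, Av⟩` (lens Sketch12 `cquad_neg`).
[cite: Balaban1988RG2Cluster, (2.14) p.15] (elementary API for (2.14)) -/
theorem cquad_neg (A : Matrix Λ Λ ℂ) (v : Λ → ℝ) : cquad A (-v) = cquad A v := by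
  simp only [cquad, Pi.neg_apply, Complex.ofReal_neg]
  exact Finset.sum_congr rfl fun i _ => Finset.sum_congr rfl fun j _ => by ring

omit [DecidableEq Λ] in
/-- **The complex Gaussian weight `e^{−½⟨B,AB⟩}` is EVEN in `B`, for ANY complex `A`** (lens Sketch12 `cgaussWeight_neg`).
[cite: Balaban1988RG2Cluster, (2.14)–(2.15) p.15] -/
theorem cgaussWeight_neg (A : Matrix Λ Λ ℂ) (v : Λ → ℝ) : cgaussWeight A (-v) = cgaussWeight A v := by
  rw [cgaussWeight, cgaussWeight, cquad_neg]

omit [DecidableEq Λ] in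
/-- **Reflection invariance of the complex Gaussian integral** — NO hypothesis (Lebesgue measure is reflection invariant; the
junk values agree; lens Sketch12 `cgaussInt_comp_neg`). [cite: Balaban1988RG2Cluster, (2.14)–(2.15) p.15] -/
theorem cgaussInt_comp_neg (A : Matrix Λ Λ ℂ) (Ψ : (Λ → ℝ) → ℂ) :
    cgaussInt A (fun v => Ψ (-v)) = cgaussInt A Ψ := by
  have h := integral_neg_eq_self (fun v => cgaussWeight A v * Ψ v) (volume : Measure (Λ → ℝ))
  simp only [cgaussWeight_neg] at h
  rw [cgaussInt, cgaussInt]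
  exact h

omit [DecidableEq Λ] in
/-- Reflection invariance of the complex Gaussian MEAN (lens Sketch12 `cgaussMean_comp_neg`).
[cite: Balaban1988RG2Cluster, (2.14)–(2.15) p.15] -/
theorem cgaussMean_comp_neg (A : Matrix Λ Λ ℂ) (Ψ : (Λ → ℝ) → ℂ) :
    cgaussMean A (fun v => Ψ (-v)) = cgaussMean A Ψ := by
  rw [cgaussMean, cgaussMean, cgaussInt_comp_neg]

omit [DecidableEq Λ] in
/-- Negation passes through the complex Gaussian integral (no hypothesis; lens Sketch12 `cgaussInt_neg`).
[cite: Balaban1988RG2Cluster, (2.14) p.15] (elementary API for (2.14)) -/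
theorem cgaussInt_neg (A : Matrix Λ Λ ℂ) (Ψ : (Λ → ℝ) → ℂ) : cgaussInt A (fun v => -Ψ v) = -cgaussInt A Ψ := by
  simp only [cgaussInt, mul_neg, integral_neg]

omit [DecidableEq Λ] in
/-- Negation passes through the complex Gaussian mean (no hypothesis; lens Sketch12 `cgaussMean_neg`).
[cite: Balaban1988RG2Cluster, (2.14) p.15] (elementary API for (2.14)) -/
theorem cgaussMean_neg (A : Matrix Λ Λ ℂ) (Ψ : (Λ → ℝ) → ℂ) : cgaussMean A (fun v => -Ψ v) = -cgaussMean A Ψ := by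
  rw [cgaussMean, cgaussMean, cgaussInt_neg, mul_neg]

omit [DecidableEq Λ] in
/-- **PARITY: an ODD integrand has zero complex Gaussian integral**, at any complex precision (lens Sketch10∕12
`cgaussInt_eq_zero_of_odd`) — [I] p. 267's *"the third, linear term … vanishes"* at the level of the measure.
[cite: Balaban1987RG1, (2.10)-(2.11) p.267; Balaban1988RG2Cluster, (2.15) p.15] -/
theorem cgaussInt_eq_zero_of_odd (A : Matrix Λ Λ ℂ) {Ψ : (Λ → ℝ) → ℂ} (hΨ : ∀ v, Ψ (-v) = -Ψ v) :
    cgaussInt A Ψ = 0 := by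
  have h1 := cgaussInt_comp_neg A Ψ
  have h2 : cgaussInt A (fun v => Ψ (-v)) = -cgaussInt A Ψ := by
    rw [← cgaussInt_neg]
    exact congrArg (cgaussInt A) (funext hΨ)
  rw [h2] at h1
  linear_combination (-(1 : ℂ) / 2) * h1

omit [DecidableEq Λ] in
/-- An ODD integrand has zero complex Gaussian MEAN (lens Sketch12 `cgaussMean_eq_zero_of_odd`).
[cite: Balaban1987RG1, (2.10)-(2.11) p.267; Balaban1988RG2Cluster, (2.15) p.15] -/
theorem cgaussMean_eq_zero_of_odd (A : Matrix Λ Λ ℂ) {Ψ : (Λ → ℝ) → ℂ} (hΨ : ∀ v, Ψ (-v) = -Ψ v) :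
    cgaussMean A Ψ = 0 := by
  rw [cgaussMean, cgaussInt_eq_zero_of_odd A hΨ, mul_zero]

omit [DecidableEq Λ] in
/-- `⟨−B, J⟩ = −⟨B, J⟩` for the coerced field (plumbing; lens Sketch12 `coe_neg_dotProduct`).
[folklore] [cite: Balaban1988RG2Cluster, (2.14) p.15] (elementary API for (2.14)) -/
theorem coe_neg_dotProduct (B : Λ → ℝ) (J : Λ → ℂ) :
    (fun i => ((-B) i : ℂ)) ⬝ᵥ J = -((fun i => (B i : ℂ)) ⬝ᵥ J) := by
  have : (fun i => ((-B) i : ℂ)) = -fun i => (B i : ℂ) := by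
    funext i; simp only [Pi.neg_apply, Complex.ofReal_neg]
  rw [this, neg_dotProduct]

omit [DecidableEq Λ] in
/-- **Reflecting the source**: `∫dμ_{A⁻¹}(B) e^{−⟨B,−J⟩} F(B) = −∫dμ_{A⁻¹}(B) e^{−⟨B,J⟩} F(B)` for an ODD last line `F`
(reflect `B`; lens Sketch12 `cgaussMean_source_neg_of_odd`). [cite: Balaban1988RG2Cluster, (2.14)–(2.15) p.15] -/
theorem cgaussMean_source_neg_of_odd (A : Matrix Λ Λ ℂ) (J : Λ → ℂ) {F : (Λ → ℝ) → ℂ}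
    (hF : ∀ B, F (-B) = -F B) :
    cgaussMean A (fun B => Complex.exp (-((fun i => (B i : ℂ)) ⬝ᵥ (-J))) * F B)
      = -cgaussMean A (fun B => Complex.exp (-((fun i => (B i : ℂ)) ⬝ᵥ J)) * F B) := by
  rw [← cgaussMean_neg,
    ← cgaussMean_comp_neg A (fun B => -(Complex.exp (-((fun i => (B i : ℂ)) ⬝ᵥ J)) * F B))]
  congr 1
  funext B
  simp only [hF, mul_neg, neg_neg]
  rw [dotProduct_neg, coe_neg_dotProduct]

variable {C₀ : Type} [Fintype C₀]

omit [DecidableEq Λ] in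
/-- **A linear source is ODD in the white noise**: `c·G·(−X) = −(c·G·X)` for the `Γ`-operators of the (2.14) capstones
(`Γ(σ)X = G(σ)·X`, and `b·G(σ)·X` along the window-dilated family). [cite: Balaban1988RG2Cluster, (2.14) p.15] (elementary API for (2.14)) -/
theorem smul_mulVec_coe_neg (c : ℂ) (G : Matrix Λ (Λ ⊕ C₀) ℂ) (X : Λ ⊕ C₀ → ℝ) :
    c • (G *ᵥ fun j => (((-X) j : ℝ) : ℂ)) = -(c • (G *ᵥ fun j => ((X j : ℝ) : ℂ))) := by
  have h1 : (fun j => (((-X) j : ℝ) : ℂ)) = -fun j => ((X j : ℝ) : ℂ) := by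
    funext j; simp only [Pi.neg_apply, Complex.ofReal_neg]
  rw [h1, Matrix.mulVec_neg, smul_neg]

omit [Fintype C₀] in
/-- **JOINT PARITY**: with an odd source `Γ` and an odd last line `F`, lines 2–3 of (2.14) are ODD in `X` (the compensator
`e^{−½⟨ΓX, A⁻¹ΓX⟩}` is even; inside the `B`-mean reflect `B ↦ −B`; lens Sketch12 `integrand214_neg_of_jointOdd`).
[cite: Balaban1988RG2Cluster, (2.14)–(2.15) p.15; Balaban1987RG1, (2.10)-(2.11) p.267] -/
theorem integrand214_neg_of_jointOdd (A : Matrix Λ Λ ℂ) {Γ : (Λ ⊕ C₀ → ℝ) → (Λ → ℂ)} {F : (Λ → ℝ) → ℂ}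
    (hΓ : ∀ X, Γ (-X) = -Γ X) (hF : ∀ B, F (-B) = -F B) (X : Λ ⊕ C₀ → ℝ) :
    integrand214 A Γ F (-X) = -integrand214 A Γ F X := by
  rw [integrand214, integrand214, hΓ, Matrix.mulVec_neg, neg_dotProduct, dotProduct_neg, neg_neg,
    cgaussMean_source_neg_of_odd A (Γ X) hF, mul_neg]

/-- **THE FIRST-ORDER TERM COSTS NOTHING**: the `dμ₀(X)`-mean of lines 2–3 of (2.14) with an odd source and an ODD last
line vanishes identically — no estimate, no contour, any complex precision `A` (lens Sketch12
`cgaussMean_integrand214_eq_zero_of_jointOdd`; the joint reflection `(B, X) ↦ (−B, −X)`).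
[cite: Balaban1987RG1, (2.10)-(2.13) pp.267-268; Balaban1988RG2Cluster, (2.14)–(2.15) p.15] -/
theorem cgaussMean_integrand214_eq_zero_of_jointOdd [DecidableEq C₀] (A : Matrix Λ Λ ℂ)
    {Γ : (Λ ⊕ C₀ → ℝ) → (Λ → ℂ)} {F : (Λ → ℝ) → ℂ} (hΓ : ∀ X, Γ (-X) = -Γ X) (hF : ∀ B, F (-B) = -F B) :
    cgaussMean (1 : Matrix (Λ ⊕ C₀) (Λ ⊕ C₀) ℂ) (fun X => integrand214 A Γ F X) = 0 :=
  cgaussMean_eq_zero_of_odd _ fun X => integrand214_neg_of_jointOdd A hΓ hF X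

/-! ## §2. Linearity of the means in the last line; integrability of the actual integrands from the letters -/

omit [DecidableEq Λ] in
/-- The complex Gaussian integral is additive on integrable integrands (lens Sketch12 `cgaussInt_sub`).
[cite: Balaban1988RG2Cluster, (2.14) p.15] (elementary API for (2.14)) -/
theorem cgaussInt_sub (A : Matrix Λ Λ ℂ) {Ψ Φ : (Λ → ℝ) → ℂ}
    (hΨ : Integrable fun v => cgaussWeight A v * Ψ v) (hΦ : Integrable fun v => cgaussWeight A v * Φ v) :
    cgaussInt A (fun v => Ψ v - Φ v) = cgaussInt A Ψ - cgaussInt A Φ := by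
  simp only [cgaussInt, mul_sub]
  exact integral_sub hΨ hΦ

omit [DecidableEq Λ] in
/-- The complex Gaussian mean is additive on integrable integrands (lens Sketch12 `cgaussMean_sub`).
[cite: Balaban1988RG2Cluster, (2.14) p.15] (elementary API for (2.14)) -/
theorem cgaussMean_sub (A : Matrix Λ Λ ℂ) {Ψ Φ : (Λ → ℝ) → ℂ}
    (hΨ : Integrable fun v => cgaussWeight A v * Ψ v) (hΦ : Integrable fun v => cgaussWeight A v * Φ v) :
    cgaussMean A (fun v => Ψ v - Φ v) = cgaussMean A Ψ - cgaussMean A Φ := by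
  rw [cgaussMean, cgaussMean, cgaussMean, cgaussInt_sub A hΨ hΦ, mul_sub]

omit [Fintype C₀] in
/-- **Lines 2–3 of (2.14) are LINEAR in the last line** (given integrability of the two inner integrands; lens Sketch12
`integrand214_sub`). [cite: Balaban1988RG2Cluster, (2.14) p.15] -/
theorem integrand214_sub (A : Matrix Λ Λ ℂ) (Γ : (Λ ⊕ C₀ → ℝ) → (Λ → ℂ)) {F F₀ : (Λ → ℝ) → ℂ} (X : Λ ⊕ C₀ → ℝ)
    (hF : Integrable fun B => cgaussWeight A B * (Complex.exp (-((fun i => (B i : ℂ)) ⬝ᵥ Γ X)) * F B))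
    (hF₀ : Integrable fun B => cgaussWeight A B * (Complex.exp (-((fun i => (B i : ℂ)) ⬝ᵥ Γ X)) * F₀ B)) :
    integrand214 A Γ (fun B => F B - F₀ B) X = integrand214 A Γ F X - integrand214 A Γ F₀ X := by
  rw [integrand214, integrand214, integrand214, ← mul_sub, ← cgaussMean_sub A hF hF₀]
  congr 2
  funext B
  simp only [mul_sub]

variable {C : Matrix Λ Λ ℝ}

/-- **The actual inner integrand of (2.14) is integrable, from the letters**: for a last line `‖F‖ ≤ Ke^{½a‖B‖²}` strongly
measurable, a source `Γ` with the `R₃` letter and a precision with the `R₂` letter against `C ≻ 0` with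
`C⁻¹ − (2ρ + a)I ≻ 0`, `B ↦ e^{−½⟨B,AB⟩}e^{−⟨B,ΓX⟩}F(B)` is integrable at every `X` — domination by the `B`-integrand of
(2.23) (`B13Core214Holomorphic.norm_innerIntegrand_le`, `B13Integral223.integrable_weight_mul_integrand`).
[cite: Balaban1988RG2Cluster, (2.15) p.15, (2.16)–(2.21) p.16, (2.23) p.17] -/
theorem integrable_inner_of_letters {A : Matrix Λ Λ ℂ} {Γ : (Λ ⊕ C₀ → ℝ) → (Λ → ℂ)} {F : (Λ → ℝ) → ℂ}
    {Γ₀ : Matrix Λ (Λ ⊕ C₀) ℝ} {ρ a K : ℝ} (hC : C.PosDef) (hα : (C⁻¹ - (2 * ρ + a) • (1 : Matrix Λ Λ ℝ)).PosDef)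
    (hR2 : ∀ B : Λ → ℝ, B ⬝ᵥ ((C⁻¹ - A.map Complex.re) *ᵥ B) ≤ ρ * (B ⬝ᵥ B))
    (hR3 : ∀ (X : Λ ⊕ C₀ → ℝ) (B : Λ → ℝ), -(B ⬝ᵥ fun i => (Γ X i).re)
      ≤ -(B ⬝ᵥ (Γ₀ *ᵥ X)) + ρ / 2 * (X ⬝ᵥ X + B ⬝ᵥ B))
    (hF : ∀ B, ‖F B‖ ≤ K * Real.exp (a / 2 * (B ⬝ᵥ B))) (hFm : StronglyMeasurable F) (X : Λ ⊕ C₀ → ℝ) :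
    Integrable fun B => cgaussWeight A B * (Complex.exp (-((fun i => (B i : ℂ)) ⬝ᵥ Γ X)) * F B) := by
  have hdom := fun B => norm_innerIntegrand_le (A := fun _ : Unit => A) (Γ := fun _ => Γ) (F := fun _ => F)
    (p := ()) hR2 hR3 hF X B
  refine Integrable.mono' (((integrable_weight_mul_integrand hC hα (Γ₀ *ᵥ X)).const_mul
    (K * Real.exp (ρ / 2 * (X ⬝ᵥ X))))) ?_ (Filter.Eventually.of_forall hdom)
  have hcont : Continuous fun B : Λ → ℝ => Complex.exp (-((fun i => (B i : ℂ)) ⬝ᵥ Γ X)) := by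
    unfold dotProduct; fun_prop
  exact ((continuous_cgaussWeight A).aestronglyMeasurable).mul
    ((hcont.stronglyMeasurable.mul hFm).aestronglyMeasurable)

/-- **The actual outer integrand of (2.14) is `dμ₀`-integrable, from the letters**: for a complex symmetric precision `A`
with `Re A ≻ 0`, a continuous source `Γ`, a strongly measurable last line `‖F‖ ≤ Ke^{½a‖B‖²}`, and the replacement letters
of pp. 15–17 (`R₁`, (2.17) twice, `R₂`, `R₃`) with the (2.24)–(2.25) smallness, `X ↦ e^{−½‖X‖²}·(lines 2–3 of (2.14))(X)`
is integrable — measurable by `B13Core214Holomorphic.aestronglyMeasurable_integrand214`, dominated by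
`e^{2η|Λ|}K·`[the integrand of (2.23)] (`norm_integrand214_le_215` → `integrand215_replace_le` → `integrable_integrand223`).
[cite: Balaban1988RG2Cluster, (2.14)–(2.15) p.15, (2.16)–(2.21) p.16, (2.23)–(2.25) p.17] -/
theorem integrable_outer_of_letters [DecidableEq C₀] {A : Matrix Λ Λ ℂ} (hAs : A.IsSymm)
    (hA : (A.map Complex.re).PosDef) {Γ : (Λ ⊕ C₀ → ℝ) → (Λ → ℂ)} (hΓc : Continuous Γ) {F : (Λ → ℝ) → ℂ}
    (hFm : StronglyMeasurable F) (hC : C.PosDef) (Γ₀ : Matrix Λ (Λ ⊕ C₀) ℝ) {ρ η a K c g : ℝ} (hρ0 : 0 ≤ ρ)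
    (ha0 : 0 ≤ a) (hK : 0 ≤ K)
    (hR1 : ∀ X : Λ ⊕ C₀ → ℝ, -(1 / 2) * ((Γ X) ⬝ᵥ (A⁻¹ *ᵥ Γ X)).re
      ≤ -(1 / 2 * ((Γ₀ *ᵥ X) ⬝ᵥ (C *ᵥ (Γ₀ *ᵥ X)))) + ρ / 2 * (X ⬝ᵥ X))
    (h17a : Real.sqrt (‖A.det‖ / (A.map Complex.re).det) ≤ Real.exp (η * Fintype.card Λ))
    (h17b : Real.sqrt ((A.map Complex.re).det / C⁻¹.det) ≤ Real.exp (η * Fintype.card Λ))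
    (hR2 : ∀ B : Λ → ℝ, B ⬝ᵥ ((C⁻¹ - A.map Complex.re) *ᵥ B) ≤ ρ * (B ⬝ᵥ B))
    (hR3 : ∀ (X : Λ ⊕ C₀ → ℝ) (B : Λ → ℝ), -(B ⬝ᵥ fun i => (Γ X i).re)
      ≤ -(B ⬝ᵥ (Γ₀ *ᵥ X)) + ρ / 2 * (X ⬝ᵥ X + B ⬝ᵥ B))
    (hF : ∀ B, ‖F B‖ ≤ K * Real.exp (a / 2 * (B ⬝ᵥ B)))
    (hc0 : 0 ≤ c) (hc : ∀ k, hC.1.eigenvalues k ≤ c) (hαc : (2 * ρ + a) * c ≤ 1 / 2)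
    (hΓq : ∀ X : Λ ⊕ C₀ → ℝ, (Γ₀ *ᵥ X) ⬝ᵥ (C *ᵥ (Γ₀ *ᵥ X)) ≤ g * (X ⬝ᵥ X))
    (hsmall : (2 * ρ + a) * (1 + 2 * c * g) < 1) :
    Integrable fun X => cgaussWeight (1 : Matrix (Λ ⊕ C₀) (Λ ⊕ C₀) ℂ) X * integrand214 A Γ F X := by
  have hα0 : 0 ≤ 2 * ρ + a := by linarith
  have hsm : (2 * ρ + a) * c < 1 := by linarith
  have hρac : (ρ + a) * c < 1 := by nlinarith
  have hα : (C⁻¹ - (2 * ρ + a) • (1 : Matrix Λ Λ ℝ)).PosDef := posDef_inv_sub_smul hC hc hsm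
  have h1re : ((1 : Matrix (Λ ⊕ C₀) (Λ ⊕ C₀) ℂ).map Complex.re) = (1 : Matrix (Λ ⊕ C₀) (Λ ⊕ C₀) ℝ) :=
    Matrix.map_one Complex.re Complex.zero_re Complex.one_re
  have hbound := (integrable_integrand223 hC Γ₀ hα0 hc0 hc hαc hΓq hsmall).const_mul
    (Real.exp (2 * η * Fintype.card Λ) * K)
  refine hbound.mono' (((continuous_cgaussWeight _).aestronglyMeasurable).mul
    (aestronglyMeasurable_integrand214 hΓc hFm)) (Filter.Eventually.of_forall fun X => ?_)
  have hg := integrable_hg215_gauss (A := A) hC K hR2 hc hρac (Γ X)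
  have h215 := norm_integrand214_le_215 hAs hA Γ F (fun B => K * Real.exp (a / 2 * (B ⬝ᵥ B))) hF X hg
  have hrep := integrand215_replace_le hA hC Γ Γ₀ ha0 hK hR1 h17a h17b hR2 hR3
    (fun B => K * Real.exp (a / 2 * (B ⬝ᵥ B))) (fun B => by positivity) (fun B => le_rfl) hα X
  rw [norm_mul, norm_cgaussWeight_eq_gaussWeight, h1re]
  calc gaussWeight (1 : Matrix (Λ ⊕ C₀) (Λ ⊕ C₀) ℝ) X * ‖integrand214 A Γ F X‖
      ≤ gaussWeight (1 : Matrix (Λ ⊕ C₀) (Λ ⊕ C₀) ℝ) X * (Real.exp (2 * η * Fintype.card Λ) * K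
          * (Real.exp (-(1 / 2 * ((Γ₀ *ᵥ X) ⬝ᵥ (C *ᵥ (Γ₀ *ᵥ X)))) + (2 * ρ + a) / 2 * (X ⬝ᵥ X))
            * innerB C (2 * ρ + a) (Γ₀ *ᵥ X))) :=
        mul_le_mul_of_nonneg_left (h215.trans hrep) (gaussWeight_pos _ X).le
    _ = Real.exp (2 * η * Fintype.card Λ) * K * (gaussWeight (1 : Matrix (Λ ⊕ C₀) (Λ ⊕ C₀) ℝ) X *
          (Real.exp (-(1 / 2 * ((Γ₀ *ᵥ X) ⬝ᵥ (C *ᵥ (Γ₀ *ᵥ X)))) + (2 * ρ + a) / 2 * (X ⬝ᵥ X))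
            * innerB C (2 * ρ + a) (Γ₀ *ᵥ X))) := by ring

/-! ## §3. The CENTRED (2.15): parity kills the odd part exactly, (2.15) prices the remainder -/

/-- **The centred (2.15), measure line**: `Ψ = Φ + ℓ + R` with `ℓ` ODD and `‖R‖ ≤ g` ⇒
`‖∫dμ_{A⁻¹}Ψ − ∫dμ_{A⁻¹}Φ‖ ≤ |det A/det Re A|^{1/2}·∫dμ_{(Re A)⁻¹} g` — print's (2.15) for the majorant of the centred
remainder (lens Sketch12 `norm_cgaussMean_sub_le_215_centred`). [cite: Balaban1988RG2Cluster, (2.15) p.15] -/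
theorem norm_cgaussMean_sub_le_215_centred {A : Matrix Λ Λ ℂ} (hAs : A.IsSymm) (hA : (A.map Complex.re).PosDef)
    (Ψ Φ ℓ : (Λ → ℝ) → ℂ) (g : (Λ → ℝ) → ℝ) (hℓ : ∀ v, ℓ (-v) = -ℓ v)
    (hΨi : Integrable fun v => cgaussWeight A v * Ψ v) (hΦi : Integrable fun v => cgaussWeight A v * Φ v)
    (hℓi : Integrable fun v => cgaussWeight A v * ℓ v)
    (hrem : ∀ v, ‖Ψ v - Φ v - ℓ v‖ ≤ g v) (hg : Integrable fun v => gaussWeight (A.map Complex.re) v * g v) :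
    ‖cgaussMean A Ψ - cgaussMean A Φ‖
      ≤ Real.sqrt (‖A.det‖ / (A.map Complex.re).det) * gaussMean (A.map Complex.re) g := by
  have hΨΦ : Integrable fun v => cgaussWeight A v * (Ψ v - Φ v) :=
    (hΨi.sub hΦi).congr (Filter.Eventually.of_forall fun v => by simp only [Pi.sub_apply, mul_sub])
  have h1 : cgaussMean A (fun v => Ψ v - Φ v - ℓ v) = cgaussMean A Ψ - cgaussMean A Φ := by
    rw [cgaussMean_sub A hΨΦ hℓi, cgaussMean_sub A hΨi hΦi, cgaussMean_eq_zero_of_odd A hℓ, sub_zero]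
  rw [← h1]
  exact norm_cgaussMean_le_215 hAs hA _ g hrem hg

/-- **THE CENTRED (2.15), lines 2–4** (lens Card T21, Sketch12 `norm_core214_sub_le_215_centred`): for a complex symmetric
precision `A` with `Re A ≻ 0`, an ODD source `Γ`, two last lines `F`, `F₀` and an ODD `ℓ` with `‖F − F₀ − ℓ‖ ≤ g`:
`‖∫dμ₀(X)(lines 2–3)(F) − ∫dμ₀(X)(lines 2–3)(F₀)‖ ≤ ∫dμ₀(X) e^{−½Re⟨ΓX,A⁻¹ΓX⟩}|det A/det Re A|^{1/2}∫dμ_{(Re A)⁻¹}(B)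
e^{−⟨B,Re ΓX⟩} g(B)` — the right-hand side of print's (2.15) for the majorant `g` OF THE CENTRED REMAINDER, the odd part
`ℓ` contributing exactly zero by joint parity (§1).  Integrability side conditions: those of
`B13FirstEstimate215.norm_core214_le_215` plus the six making the means linear (§2 discharges them from the letters).
[cite: Balaban1988RG2Cluster, (2.15) p.15; Balaban1987RG1, (2.13) p.268] -/
theorem norm_core214_sub_le_215_centred [DecidableEq C₀] {A : Matrix Λ Λ ℂ} (hAs : A.IsSymm)
    (hA : (A.map Complex.re).PosDef) {Γ : (Λ ⊕ C₀ → ℝ) → (Λ → ℂ)} (hΓ : ∀ X, Γ (-X) = -Γ X)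
    (F F₀ ℓ : (Λ → ℝ) → ℂ) (hℓ : ∀ B, ℓ (-B) = -ℓ B) (g : (Λ → ℝ) → ℝ)
    (hrem : ∀ B, ‖F B - F₀ B - ℓ B‖ ≤ g B)
    (hIF : ∀ X, Integrable fun B => cgaussWeight A B * (Complex.exp (-((fun i => (B i : ℂ)) ⬝ᵥ Γ X)) * F B))
    (hIF₀ : ∀ X, Integrable fun B => cgaussWeight A B * (Complex.exp (-((fun i => (B i : ℂ)) ⬝ᵥ Γ X)) * F₀ B))
    (hIℓ : ∀ X, Integrable fun B => cgaussWeight A B * (Complex.exp (-((fun i => (B i : ℂ)) ⬝ᵥ Γ X)) * ℓ B))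
    (hOF : Integrable fun X => cgaussWeight (1 : Matrix (Λ ⊕ C₀) (Λ ⊕ C₀) ℂ) X * integrand214 A Γ F X)
    (hOF₀ : Integrable fun X => cgaussWeight (1 : Matrix (Λ ⊕ C₀) (Λ ⊕ C₀) ℂ) X * integrand214 A Γ F₀ X)
    (hOℓ : Integrable fun X => cgaussWeight (1 : Matrix (Λ ⊕ C₀) (Λ ⊕ C₀) ℂ) X * integrand214 A Γ ℓ X)
    (hg : ∀ X : Λ ⊕ C₀ → ℝ, Integrable (fun B : Λ → ℝ =>
      gaussWeight (A.map Complex.re) B * (Real.exp (-(B ⬝ᵥ fun i => (Γ X i).re)) * g B)))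
    (hX : Integrable (fun X : Λ ⊕ C₀ → ℝ => gaussWeight (1 : Matrix (Λ ⊕ C₀) (Λ ⊕ C₀) ℝ) X *
      (Real.exp (-(1 / 2) * ((Γ X) ⬝ᵥ (A⁻¹ *ᵥ Γ X)).re)
        * (Real.sqrt (‖A.det‖ / (A.map Complex.re).det)
          * gaussMean (A.map Complex.re) (fun B => Real.exp (-(B ⬝ᵥ fun i => (Γ X i).re)) * g B))))) :
    ‖cgaussMean (1 : Matrix (Λ ⊕ C₀) (Λ ⊕ C₀) ℂ) (fun X => integrand214 A Γ F X)
        - cgaussMean (1 : Matrix (Λ ⊕ C₀) (Λ ⊕ C₀) ℂ) (fun X => integrand214 A Γ F₀ X)‖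
      ≤ gaussMean (1 : Matrix (Λ ⊕ C₀) (Λ ⊕ C₀) ℝ) (fun X =>
          Real.exp (-(1 / 2) * ((Γ X) ⬝ᵥ (A⁻¹ *ᵥ Γ X)).re)
            * (Real.sqrt (‖A.det‖ / (A.map Complex.re).det)
              * gaussMean (A.map Complex.re) (fun B => Real.exp (-(B ⬝ᵥ fun i => (Γ X i).re)) * g B))) := by
  -- inner integrability of the differences
  have hIFF₀ : ∀ X, Integrable fun B => cgaussWeight A B *
      (Complex.exp (-((fun i => (B i : ℂ)) ⬝ᵥ Γ X)) * (F B - F₀ B)) := fun X =>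
    ((hIF X).sub (hIF₀ X)).congr (Filter.Eventually.of_forall fun B => by simp only [Pi.sub_apply]; ring)
  -- pointwise: integrand(F − F₀ − ℓ) = integrand F − integrand F₀ − integrand ℓ
  have hpt : ∀ X, integrand214 A Γ (fun B => F B - F₀ B - ℓ B) X
      = integrand214 A Γ F X - integrand214 A Γ F₀ X - integrand214 A Γ ℓ X := fun X => by
    rw [integrand214_sub A Γ X (hIFF₀ X) (hIℓ X), integrand214_sub A Γ X (hIF X) (hIF₀ X)]
  -- outer integrability of the difference
  have hOFF₀ : Integrable fun X => cgaussWeight (1 : Matrix (Λ ⊕ C₀) (Λ ⊕ C₀) ℂ) X *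
      (integrand214 A Γ F X - integrand214 A Γ F₀ X) :=
    (hOF.sub hOF₀).congr (Filter.Eventually.of_forall fun X => by simp only [Pi.sub_apply]; ring)
  -- the centred mean IS the mean of the centred remainder
  have key : cgaussMean (1 : Matrix (Λ ⊕ C₀) (Λ ⊕ C₀) ℂ) (fun X => integrand214 A Γ F X)
        - cgaussMean (1 : Matrix (Λ ⊕ C₀) (Λ ⊕ C₀) ℂ) (fun X => integrand214 A Γ F₀ X)
      = cgaussMean (1 : Matrix (Λ ⊕ C₀) (Λ ⊕ C₀) ℂ) (fun X => integrand214 A Γ (fun B => F B - F₀ B - ℓ B) X) := by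
    have e1 : cgaussMean (1 : Matrix (Λ ⊕ C₀) (Λ ⊕ C₀) ℂ) (fun X => integrand214 A Γ (fun B => F B - F₀ B - ℓ B) X)
        = cgaussMean (1 : Matrix (Λ ⊕ C₀) (Λ ⊕ C₀) ℂ)
            (fun X => (integrand214 A Γ F X - integrand214 A Γ F₀ X) - integrand214 A Γ ℓ X) :=
      congrArg (cgaussMean _) (funext hpt)
    rw [e1, cgaussMean_sub _ hOFF₀ hOℓ, cgaussMean_sub _ hOF hOF₀,
      cgaussMean_integrand214_eq_zero_of_jointOdd A hΓ hℓ, sub_zero]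
  rw [key]
  exact norm_core214_le_215 hAs hA Γ _ g hrem hg hX

/-- `‖e^w − 1 − w‖ ≤ ‖w‖² e^{‖w‖}` (Mathlib `Complex.norm_exp_sub_sum_le_norm_mul_exp`, `n = 2`; lens Sketch12
`norm_cexp_sub_one_sub_le`). [folklore] [cite: Balaban1987RG1, (2.13) p.268] (elementary API for the second-order remainder) -/
theorem norm_cexp_sub_one_sub_le (w : ℂ) : ‖Complex.exp w - 1 - w‖ ≤ ‖w‖ ^ 2 * Real.exp ‖w‖ := by
  have h := Complex.norm_exp_sub_sum_le_norm_mul_exp w 2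
  have hs : ∑ m ∈ range 2, w ^ m / (m.factorial : ℂ) = 1 + w := by
    simp [Finset.sum_range_succ]
  rwa [hs, sub_add_eq_sub_sub] at h

/-- The factorised centred exponential: `‖e^{a+w} − e^a − e^a·w₁‖ ≤ |e^a|·(‖w − w₁‖ + ‖w‖²e^{‖w‖})` (lens Sketch12
`norm_cexp_add_sub_sub_le`). [folklore] [cite: Balaban1987RG1, (2.13) p.268] (elementary API for the second-order remainder) -/
theorem norm_cexp_add_sub_sub_le (a w w₁ : ℂ) :
    ‖Complex.exp (a + w) - Complex.exp a - Complex.exp a * w₁‖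
      ≤ ‖Complex.exp a‖ * (‖w - w₁‖ + ‖w‖ ^ 2 * Real.exp ‖w‖) := by
  have h : Complex.exp (a + w) - Complex.exp a - Complex.exp a * w₁
      = Complex.exp a * ((Complex.exp w - 1 - w) + (w - w₁)) := by
    rw [Complex.exp_add]; ring
  rw [h, norm_mul]
  refine mul_le_mul_of_nonneg_left ?_ (norm_nonneg _)
  calc ‖(Complex.exp w - 1 - w) + (w - w₁)‖
      ≤ ‖Complex.exp w - 1 - w‖ + ‖w - w₁‖ := norm_add_le _ _
    _ ≤ ‖w‖ ^ 2 * Real.exp ‖w‖ + ‖w - w₁‖ := add_le_add (norm_cexp_sub_one_sub_le w) le_rfl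
    _ = ‖w - w₁‖ + ‖w‖ ^ 2 * Real.exp ‖w‖ := add_comm _ _

section LastLine

variable {D : Type*}

omit [Fintype Λ] [DecidableEq Λ] in
/-- Algebra of the centred printed last line: `F214(𝐕) − F214(𝐕₀) − F214(𝐕₀)·Σ τ𝐕₁ = (−1)^{|P|}χχᶜ·(e^{a+w} − e^a − e^a w₁)`
with `a = Σ τ𝐕₀`, `w = Σ τ(𝐕 − 𝐕₀)`, `w₁ = Σ τ𝐕₁` (lens Sketch12 `F214_centred_eq`). [cite: Balaban1988RG2Cluster, (2.14) p.15] -/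
theorem F214_centred_eq (cardP : ℕ) (χY₀ χcP : (Λ → ℝ) → ℝ) (Dfam : Finset D) (V V₀ V₁ : D → (Λ → ℝ) → ℂ)
    (τ : D → ℂ) (B : Λ → ℝ) :
    F214 cardP χY₀ χcP Dfam V τ B - F214 cardP χY₀ χcP Dfam V₀ τ B
        - F214 cardP χY₀ χcP Dfam V₀ τ B * ∑ Y ∈ Dfam, τ Y * V₁ Y B
      = ((-1) ^ cardP * (χY₀ B : ℂ) * (χcP B : ℂ))
        * (Complex.exp ((∑ Y ∈ Dfam, τ Y * V₀ Y B) + ∑ Y ∈ Dfam, τ Y * (V Y B - V₀ Y B))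
            - Complex.exp (∑ Y ∈ Dfam, τ Y * V₀ Y B)
            - Complex.exp (∑ Y ∈ Dfam, τ Y * V₀ Y B) * ∑ Y ∈ Dfam, τ Y * V₁ Y B) := by
  have hsum : ∑ Y ∈ Dfam, τ Y * V Y B
      = (∑ Y ∈ Dfam, τ Y * V₀ Y B) + ∑ Y ∈ Dfam, τ Y * (V Y B - V₀ Y B) := by
    rw [← Finset.sum_add_distrib]
    exact Finset.sum_congr rfl fun Y _ => by ring
  simp only [F214]
  rw [hsum]
  ring

omit [Fintype Λ] [DecidableEq Λ] in
/-- **THE CENTRED PRINTED LAST LINE, pointwise** (lens Sketch12 `norm_F214_centred_le`):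
`‖F214(𝐕) − F214(𝐕₀) − F214(𝐕₀)Σ τ𝐕₁‖ ≤ χχᶜ e^{Σ|τ||𝐕₀|}·(Σ|τ||𝐕−𝐕₀−𝐕₁| + (Σ|τ||𝐕−𝐕₀|)² e^{Σ|τ||𝐕−𝐕₀|})` (characteristic functions
`≥ 0`). [cite: Balaban1988RG2Cluster, (2.14)–(2.15) p.15, (2.20) p.16; Balaban1987RG1, (2.13) p.268] -/
theorem norm_F214_centred_le (cardP : ℕ) (χY₀ χcP : (Λ → ℝ) → ℝ) (Dfam : Finset D)
    (V V₀ V₁ : D → (Λ → ℝ) → ℂ) (τ : D → ℂ) (B : Λ → ℝ) (hχ0 : 0 ≤ χY₀ B) (hχc0 : 0 ≤ χcP B) :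
    ‖F214 cardP χY₀ χcP Dfam V τ B - F214 cardP χY₀ χcP Dfam V₀ τ B
        - F214 cardP χY₀ χcP Dfam V₀ τ B * ∑ Y ∈ Dfam, τ Y * V₁ Y B‖
      ≤ χY₀ B * χcP B * Real.exp (∑ Y ∈ Dfam, ‖τ Y‖ * ‖V₀ Y B‖)
          * ((∑ Y ∈ Dfam, ‖τ Y‖ * ‖V Y B - V₀ Y B - V₁ Y B‖)
             + (∑ Y ∈ Dfam, ‖τ Y‖ * ‖V Y B - V₀ Y B‖) ^ 2
                * Real.exp (∑ Y ∈ Dfam, ‖τ Y‖ * ‖V Y B - V₀ Y B‖)) := by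
  rw [F214_centred_eq, norm_mul]
  have hpref : ‖((-1 : ℂ) ^ cardP * (χY₀ B : ℂ) * (χcP B : ℂ))‖ = χY₀ B * χcP B := by
    rw [norm_mul, norm_mul, norm_pow, norm_neg, norm_one, one_pow, one_mul, Complex.norm_real, Complex.norm_real,
      Real.norm_eq_abs, Real.norm_eq_abs, abs_of_nonneg hχ0, abs_of_nonneg hχc0]
  rw [hpref, mul_assoc (χY₀ B * χcP B)]
  refine mul_le_mul_of_nonneg_left ?_ (mul_nonneg hχ0 hχc0)
  set a : ℂ := ∑ Y ∈ Dfam, τ Y * V₀ Y B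
  set w : ℂ := ∑ Y ∈ Dfam, τ Y * (V Y B - V₀ Y B)
  set w₁ : ℂ := ∑ Y ∈ Dfam, τ Y * V₁ Y B
  have ha : ‖Complex.exp a‖ ≤ Real.exp (∑ Y ∈ Dfam, ‖τ Y‖ * ‖V₀ Y B‖) := by
    rw [Complex.norm_exp]
    refine Real.exp_le_exp.2 ?_
    rw [Complex.re_sum]
    exact Finset.sum_le_sum fun Y _ => (Complex.re_le_norm _).trans (norm_mul_le _ _)
  have hw₁ : ‖w - w₁‖ ≤ ∑ Y ∈ Dfam, ‖τ Y‖ * ‖V Y B - V₀ Y B - V₁ Y B‖ := by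
    have : w - w₁ = ∑ Y ∈ Dfam, τ Y * (V Y B - V₀ Y B - V₁ Y B) := by
      rw [← Finset.sum_sub_distrib]
      exact Finset.sum_congr rfl fun Y _ => by ring
    rw [this]
    exact (norm_sum_le _ _).trans (Finset.sum_le_sum fun Y _ => (norm_mul _ _).le)
  have hw : ‖w‖ ≤ ∑ Y ∈ Dfam, ‖τ Y‖ * ‖V Y B - V₀ Y B‖ :=
    (norm_sum_le _ _).trans (Finset.sum_le_sum fun Y _ => (norm_mul _ _).le)
  refine (norm_cexp_add_sub_sub_le a w w₁).trans ?_
  refine mul_le_mul ha ?_ (by positivity) (by positivity)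
  refine add_le_add hw₁ ?_
  exact mul_le_mul (pow_le_pow_left₀ (norm_nonneg _) hw 2) (Real.exp_le_exp.2 hw) (by positivity) (by positivity)

omit [Fintype Λ] [DecidableEq Λ] in
/-- **The centred printed last line under CONSTANT Taylor letters** (lens Sketch12 `norm_F214_centred_le_sq`): if
`Σ|τ||𝐕₀| ≤ E₀`, `Σ|τ||𝐕 − 𝐕₀| ≤ s·G₁`, `Σ|τ||𝐕 − 𝐕₀ − 𝐕₁| ≤ s²·G₂` then
`‖F214(𝐕) − F214(𝐕₀) − F214(𝐕₀)Σ τ𝐕₁‖ ≤ s²·χχᶜ·e^{E₀ + sG₁}·(G₂ + G₁²)`. [cite: Balaban1988RG2Cluster, (2.15) p.15, (2.20) p.16; Balaban1987RG1, (2.13) p.268] -/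
theorem norm_F214_centred_le_sq (cardP : ℕ) (χY₀ χcP : (Λ → ℝ) → ℝ) (Dfam : Finset D)
    (V V₀ V₁ : D → (Λ → ℝ) → ℂ) (τ : D → ℂ) (B : Λ → ℝ) (hχ0 : 0 ≤ χY₀ B) (hχc0 : 0 ≤ χcP B)
    {s E₀ G₁ G₂ : ℝ} (hs : 0 ≤ s) (hG₁ : 0 ≤ G₁) (hG₂ : 0 ≤ G₂)
    (hE₀ : ∑ Y ∈ Dfam, ‖τ Y‖ * ‖V₀ Y B‖ ≤ E₀)
    (h1 : ∑ Y ∈ Dfam, ‖τ Y‖ * ‖V Y B - V₀ Y B‖ ≤ s * G₁)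
    (h2 : ∑ Y ∈ Dfam, ‖τ Y‖ * ‖V Y B - V₀ Y B - V₁ Y B‖ ≤ s ^ 2 * G₂) :
    ‖F214 cardP χY₀ χcP Dfam V τ B - F214 cardP χY₀ χcP Dfam V₀ τ B
        - F214 cardP χY₀ χcP Dfam V₀ τ B * ∑ Y ∈ Dfam, τ Y * V₁ Y B‖
      ≤ s ^ 2 * (χY₀ B * χcP B * Real.exp (E₀ + s * G₁) * (G₂ + G₁ ^ 2)) := by
  refine (norm_F214_centred_le cardP χY₀ χcP Dfam V V₀ V₁ τ B hχ0 hχc0).trans ?_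
  have hS₁ : 0 ≤ ∑ Y ∈ Dfam, ‖τ Y‖ * ‖V Y B - V₀ Y B‖ :=
    Finset.sum_nonneg fun Y _ => mul_nonneg (norm_nonneg _) (norm_nonneg _)
  have e1 : Real.exp (∑ Y ∈ Dfam, ‖τ Y‖ * ‖V₀ Y B‖) ≤ Real.exp E₀ := Real.exp_le_exp.2 hE₀
  have e2 : (∑ Y ∈ Dfam, ‖τ Y‖ * ‖V Y B - V₀ Y B - V₁ Y B‖)
        + (∑ Y ∈ Dfam, ‖τ Y‖ * ‖V Y B - V₀ Y B‖) ^ 2 * Real.exp (∑ Y ∈ Dfam, ‖τ Y‖ * ‖V Y B - V₀ Y B‖)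
      ≤ s ^ 2 * G₂ + (s * G₁) ^ 2 * Real.exp (s * G₁) :=
    add_le_add h2 (mul_le_mul (pow_le_pow_left₀ hS₁ h1 2) (Real.exp_le_exp.2 h1) (by positivity) (by positivity))
  have e3 : s ^ 2 * G₂ + (s * G₁) ^ 2 * Real.exp (s * G₁) ≤ s ^ 2 * ((G₂ + G₁ ^ 2) * Real.exp (s * G₁)) := by
    have h1e : 1 ≤ Real.exp (s * G₁) := Real.one_le_exp (mul_nonneg hs hG₁)
    have key : s ^ 2 * G₂ ≤ s ^ 2 * G₂ * Real.exp (s * G₁) :=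
      le_mul_of_one_le_right (mul_nonneg (sq_nonneg _) hG₂) h1e
    calc s ^ 2 * G₂ + (s * G₁) ^ 2 * Real.exp (s * G₁)
        ≤ s ^ 2 * G₂ * Real.exp (s * G₁) + (s * G₁) ^ 2 * Real.exp (s * G₁) := add_le_add key le_rfl
      _ = s ^ 2 * ((G₂ + G₁ ^ 2) * Real.exp (s * G₁)) := by ring
  calc χY₀ B * χcP B * Real.exp (∑ Y ∈ Dfam, ‖τ Y‖ * ‖V₀ Y B‖)
          * ((∑ Y ∈ Dfam, ‖τ Y‖ * ‖V Y B - V₀ Y B - V₁ Y B‖)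
             + (∑ Y ∈ Dfam, ‖τ Y‖ * ‖V Y B - V₀ Y B‖) ^ 2
                * Real.exp (∑ Y ∈ Dfam, ‖τ Y‖ * ‖V Y B - V₀ Y B‖))
      ≤ χY₀ B * χcP B * Real.exp E₀ * (s ^ 2 * ((G₂ + G₁ ^ 2) * Real.exp (s * G₁))) :=
        mul_le_mul (mul_le_mul_of_nonneg_left e1 (mul_nonneg hχ0 hχc0)) (e2.trans e3) (by positivity)
          (by positivity)
    _ = s ^ 2 * (χY₀ B * χcP B * Real.exp (E₀ + s * G₁) * (G₂ + G₁ ^ 2)) := by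
        rw [Real.exp_add]; ring

omit [DecidableEq Λ] in
/-- **The centred printed last line under (2.20)-SHAPED Taylor letters — a Gaussian-shaped majorant.**  If
`Σ|τ||𝐕₀| ≤ w₀` (the reference potentials: a field-constant background value in the application), `Σ|τ||𝐕 − 𝐕₀| ≤
s·(½a₁‖B‖² + w₁)` and `Σ|τ||𝐕 − 𝐕₀ − 𝐕₁| ≤ s²·(½a₂‖B‖² + w₂)` (first- and second-order Taylor letters in the currency of
(2.20)), and `a_c` dominates `a₂` and `(1+s)a₁`, then
`‖F214(𝐕) − F214(𝐕₀) − F214(𝐕₀)Σ τ𝐕₁‖ ≤ s²·χχᶜ·e^{w₀}(e^{w₂} + 2e^{(1+s)w₁})·e^{½a_c‖B‖²}` — the shape `ψ ≤ Ke^{½a‖B‖²}` of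
the last-line majorant in `B13Replacement223.replaced_le_226`, with `s²` in front (`y ≤ e^y`, `y² ≤ 2e^y` — `Real.quadratic_le_exp_of_nonneg`).
[cite: Balaban1988RG2Cluster, (2.15) p.15, (2.20) p.16, (2.23) p.17; Balaban1987RG1, (2.13) p.268] -/
theorem norm_F214_centred_le_gauss (cardP : ℕ) (χY₀ χcP : (Λ → ℝ) → ℝ) (Dfam : Finset D)
    (V V₀ V₁ : D → (Λ → ℝ) → ℂ) (τ : D → ℂ) (B : Λ → ℝ) (hχ0 : 0 ≤ χY₀ B) (hχc0 : 0 ≤ χcP B)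
    {s a₁ w₁ a₂ w₂ w₀ ac : ℝ} (hs : 0 ≤ s) (ha₁ : 0 ≤ a₁) (hw₁ : 0 ≤ w₁) (ha₂ : 0 ≤ a₂) (hw₂ : 0 ≤ w₂)
    (hac₂ : a₂ ≤ ac) (hac₁ : (1 + s) * a₁ ≤ ac)
    (hw₀ : ∑ Y ∈ Dfam, ‖τ Y‖ * ‖V₀ Y B‖ ≤ w₀)
    (h1 : ∑ Y ∈ Dfam, ‖τ Y‖ * ‖V Y B - V₀ Y B‖ ≤ s * (a₁ / 2 * (B ⬝ᵥ B) + w₁))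
    (h2 : ∑ Y ∈ Dfam, ‖τ Y‖ * ‖V Y B - V₀ Y B - V₁ Y B‖ ≤ s ^ 2 * (a₂ / 2 * (B ⬝ᵥ B) + w₂)) :
    ‖F214 cardP χY₀ χcP Dfam V τ B - F214 cardP χY₀ χcP Dfam V₀ τ B
        - F214 cardP χY₀ χcP Dfam V₀ τ B * ∑ Y ∈ Dfam, τ Y * V₁ Y B‖
      ≤ s ^ 2 * (χY₀ B * χcP B * (Real.exp w₀ * (Real.exp w₂ + 2 * Real.exp ((1 + s) * w₁))
          * Real.exp (ac / 2 * (B ⬝ᵥ B)))) := by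
  refine (norm_F214_centred_le cardP χY₀ χcP Dfam V V₀ V₁ τ B hχ0 hχc0).trans ?_
  have hBB : 0 ≤ B ⬝ᵥ B := Finset.sum_nonneg fun i _ => mul_self_nonneg (B i)
  set y₁ : ℝ := a₁ / 2 * (B ⬝ᵥ B) + w₁ with hy₁
  set y₂ : ℝ := a₂ / 2 * (B ⬝ᵥ B) + w₂ with hy₂
  have hy₁0 : 0 ≤ y₁ := by positivity
  have hy₂0 : 0 ≤ y₂ := by positivity
  -- `y² ≤ 2e^y` for `y ≥ 0` (from `1 + y + y²/2 ≤ e^y`; the tree's `Literature.Analysis.FluidPDE.sq_le_two_mul_exp`)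
  have hsq : y₁ ^ 2 ≤ 2 * Real.exp y₁ := by
    have h := Real.quadratic_le_exp_of_nonneg hy₁0
    nlinarith
  have hS₁ : 0 ≤ ∑ Y ∈ Dfam, ‖τ Y‖ * ‖V Y B - V₀ Y B‖ :=
    Finset.sum_nonneg fun Y _ => mul_nonneg (norm_nonneg _) (norm_nonneg _)
  -- the two remainder pieces against Gaussians
  have hterm2 : ∑ Y ∈ Dfam, ‖τ Y‖ * ‖V Y B - V₀ Y B - V₁ Y B‖ ≤ s ^ 2 * Real.exp y₂ :=
    h2.trans (mul_le_mul_of_nonneg_left (by linarith [Real.add_one_le_exp y₂]) (sq_nonneg _))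
  have hterm1 : (∑ Y ∈ Dfam, ‖τ Y‖ * ‖V Y B - V₀ Y B‖) ^ 2 * Real.exp (∑ Y ∈ Dfam, ‖τ Y‖ * ‖V Y B - V₀ Y B‖)
      ≤ s ^ 2 * (2 * Real.exp ((1 + s) * y₁)) := by
    have hsy : 0 ≤ s * y₁ := mul_nonneg hs hy₁0
    calc (∑ Y ∈ Dfam, ‖τ Y‖ * ‖V Y B - V₀ Y B‖) ^ 2 * Real.exp (∑ Y ∈ Dfam, ‖τ Y‖ * ‖V Y B - V₀ Y B‖)
        ≤ (s * y₁) ^ 2 * Real.exp (s * y₁) :=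
          mul_le_mul (pow_le_pow_left₀ hS₁ h1 2) (Real.exp_le_exp.2 h1) (by positivity) (by positivity)
      _ = s ^ 2 * (y₁ ^ 2 * Real.exp (s * y₁)) := by ring
      _ ≤ s ^ 2 * (2 * Real.exp y₁ * Real.exp (s * y₁)) :=
          mul_le_mul_of_nonneg_left (mul_le_mul_of_nonneg_right hsq (Real.exp_pos _).le)
            (sq_nonneg _)
      _ = s ^ 2 * (2 * Real.exp ((1 + s) * y₁)) := by
          rw [mul_assoc 2, ← Real.exp_add]; congr 2; ring
  -- the Gaussian rates against `ac`
  have hg₂ : Real.exp y₂ ≤ Real.exp w₂ * Real.exp (ac / 2 * (B ⬝ᵥ B)) := by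
    rw [← Real.exp_add]; refine Real.exp_le_exp.2 ?_; rw [hy₂]; nlinarith
  have hg₁ : Real.exp ((1 + s) * y₁) ≤ Real.exp ((1 + s) * w₁) * Real.exp (ac / 2 * (B ⬝ᵥ B)) := by
    rw [← Real.exp_add]; refine Real.exp_le_exp.2 ?_; rw [hy₁]; nlinarith
  have hw0e : Real.exp (∑ Y ∈ Dfam, ‖τ Y‖ * ‖V₀ Y B‖) ≤ Real.exp w₀ := Real.exp_le_exp.2 hw₀
  calc χY₀ B * χcP B * Real.exp (∑ Y ∈ Dfam, ‖τ Y‖ * ‖V₀ Y B‖)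
          * ((∑ Y ∈ Dfam, ‖τ Y‖ * ‖V Y B - V₀ Y B - V₁ Y B‖)
             + (∑ Y ∈ Dfam, ‖τ Y‖ * ‖V Y B - V₀ Y B‖) ^ 2
                * Real.exp (∑ Y ∈ Dfam, ‖τ Y‖ * ‖V Y B - V₀ Y B‖))
      ≤ χY₀ B * χcP B * Real.exp w₀ * (s ^ 2 * Real.exp y₂ + s ^ 2 * (2 * Real.exp ((1 + s) * y₁))) :=
        mul_le_mul (mul_le_mul_of_nonneg_left hw0e (mul_nonneg hχ0 hχc0)) (add_le_add hterm2 hterm1)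
          (by positivity) (by positivity)
    _ ≤ χY₀ B * χcP B * Real.exp w₀ * (s ^ 2 * (Real.exp w₂ * Real.exp (ac / 2 * (B ⬝ᵥ B)))
          + s ^ 2 * (2 * (Real.exp ((1 + s) * w₁) * Real.exp (ac / 2 * (B ⬝ᵥ B))))) := by
        gcongr
    _ = s ^ 2 * (χY₀ B * χcP B * (Real.exp w₀ * (Real.exp w₂ + 2 * Real.exp ((1 + s) * w₁))
          * Real.exp (ac / 2 * (B ⬝ᵥ B)))) := by ring

omit [Fintype Λ] [DecidableEq Λ] in
/-- The printed last line is EVEN in `B` when the characteristic functions and the potentials are (lens Sketch12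
`F214_neg_of_even`). [cite: Balaban1988RG2Cluster, (2.14) p.15] -/
theorem F214_neg_of_even (cardP : ℕ) {χY₀ χcP : (Λ → ℝ) → ℝ} (Dfam : Finset D) {V₀ : D → (Λ → ℝ) → ℂ}
    (τ : D → ℂ) (hχe : ∀ B, χY₀ (-B) = χY₀ B) (hχce : ∀ B, χcP (-B) = χcP B)
    (hV₀ : ∀ Y B, V₀ Y (-B) = V₀ Y B) (B : Λ → ℝ) :
    F214 cardP χY₀ χcP Dfam V₀ τ (-B) = F214 cardP χY₀ χcP Dfam V₀ τ B := by
  simp only [F214, hχe, hχce, hV₀]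

omit [Fintype Λ] [DecidableEq Λ] in
/-- **The linear part `ℓ = F214(𝐕₀)·Σ τ(Y)𝐕₁(Y,·)` IS ODD** when `χ`'s and `𝐕₀` are even and `𝐕₁` is odd in `B` — pure
gauge: boxes are norms, the action is even in the field, the cubic vertex and the first field-derivative of the older terms
are odd ([I] p. 267); the hypothesis `hℓ` of `norm_core214_sub_le_215_centred` (lens Sketch12 `centredLinearPart_odd`).
[cite: Balaban1987RG1, (2.10)-(2.11) p.267; Balaban1988RG2Cluster, (2.14) p.15] -/
theorem centredLinearPart_odd (cardP : ℕ) {χY₀ χcP : (Λ → ℝ) → ℝ} (Dfam : Finset D) {V₀ V₁ : D → (Λ → ℝ) → ℂ}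
    (τ : D → ℂ) (hχe : ∀ B, χY₀ (-B) = χY₀ B) (hχce : ∀ B, χcP (-B) = χcP B)
    (hV₀ : ∀ Y B, V₀ Y (-B) = V₀ Y B) (hV₁ : ∀ Y B, V₁ Y (-B) = -V₁ Y B) (B : Λ → ℝ) :
    F214 cardP χY₀ χcP Dfam V₀ τ (-B) * ∑ Y ∈ Dfam, τ Y * V₁ Y (-B)
      = -(F214 cardP χY₀ χcP Dfam V₀ τ B * ∑ Y ∈ Dfam, τ Y * V₁ Y B) := by
  rw [F214_neg_of_even cardP Dfam τ hχe hχce hV₀ B]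
  simp only [hV₁, mul_neg, Finset.sum_neg_distrib]

end LastLine

/-! ## §4. The centre: a field-constant last line makes lines 2–3 of (2.14) constant -/

omit [Fintype C₀] in
/-- **With a CONSTANT last line `c`, lines 2–3 of (2.14) equal `c` identically in `X`** as soon as the complex Gaussian
generating-function identity `∫dμ_{A⁻¹}(B) e^{−⟨B,J⟩} = e^{½⟨J,A⁻¹J⟩}` holds at `J = ΓX` (the translation behind (2.5)∕(2.6):
`B13GaugeDevices.integral_linear_shift` ∕ `ratio_25` at REAL parameters; at complex `σ` by holomorphy) — the compensator
`e^{−½⟨ΓX,A⁻¹ΓX⟩}` of (2.14) is designed to cancel it.  With `B13SigmaFreeKernels.term214_sigmaFree` this says: the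
zero-coupling member of a term carrying a σ(Δ)-operation VANISHES — its centre is `0` and the centred letter is an
`O(s²)`-improved uncentred letter (lens Card T22, Sketch12 `integrand214_const_of_mgf`).
[cite: Balaban1988RG2Cluster, (2.5)–(2.6) pp.12–13, (2.14) p.15] -/
theorem integrand214_const_of_mgf (A : Matrix Λ Λ ℂ) (Γ : (Λ ⊕ C₀ → ℝ) → (Λ → ℂ)) (c : ℂ) (X : Λ ⊕ C₀ → ℝ)
    (hmgf : cgaussMean A (fun B => Complex.exp (-((fun i => (B i : ℂ)) ⬝ᵥ Γ X)))
      = Complex.exp ((1 / 2 : ℂ) * (Γ X ⬝ᵥ (A⁻¹ *ᵥ Γ X)))) :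
    integrand214 A Γ (fun _ => c) X = c := by
  have hmul : cgaussMean A (fun B => Complex.exp (-((fun i => (B i : ℂ)) ⬝ᵥ Γ X)) * c)
      = cgaussMean A (fun B => Complex.exp (-((fun i => (B i : ℂ)) ⬝ᵥ Γ X))) * c := by
    rw [cgaussMean, cgaussMean, cgaussInt, cgaussInt, mul_assoc, ← integral_mul_const]
    congr 1
    refine integral_congr_ae (Filter.Eventually.of_forall fun v => ?_)
    show cgaussWeight A v * (Complex.exp (-((fun i => (v i : ℂ)) ⬝ᵥ Γ X)) * c)
      = cgaussWeight A v * Complex.exp (-((fun i => (v i : ℂ)) ⬝ᵥ Γ X)) * c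
    ring
  rw [integrand214, hmul, hmgf, ← mul_assoc, ← Complex.exp_add]
  have : -(1 / 2 : ℂ) * (Γ X ⬝ᵥ (A⁻¹ *ᵥ Γ X)) + (1 / 2 : ℂ) * (Γ X ⬝ᵥ (A⁻¹ *ᵥ Γ X)) = 0 := by ring
  rw [this, Complex.exp_zero, one_mul]

end Literature.MathematicalPhysics.QuantumFieldTheory.Balaban1983to89.B13Term214Centred

end
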